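import Summits.QuantumFields.BalabanUV.Beta.SymmetrisedLoopWords

/-!
# `BalabanUV.Beta.SymmetrisedContourOrder` — binder row D1, RULING R-D1-g25-1 step S1c (part 1 of I-d1ref34-2 (i)): THE σ-COMB DEPENDS ON THE AXIS
# ORDER σ ONLY THROUGH THE INDUCED ORDER OF THE MOVING AXES — `axialPermList σ A y x = stairFrom (combOrder σ y x) A y x` — i.e. the letter list of
# `Γ^σ_{y,x}` is the staircase word of the list `combOrder σ y x` of the axes `i` with `x i ≠ y i` in the order σ(d−1), …, σ(0) (idle axes contribute
# EMPTY segments): the «contour generated by the permutation» of [Balaban1987RG1] p.252 as a function of the full order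

HONEST FRAMING (cell contract, verbatim): «discharging `BetaPertH` makes Bałaban's UV stability UNCONDITIONAL — a real constructive-QFT
result; it is NOT the continuum limit and NOT the Clay problem.»  THIS MODULE DISCHARGES NOTHING of `BetaPertH` ∕ row D1: [folklore] list
bookkeeping on `ℤ^d`.  0 sorry, 0 `def … : Prop`, nothing cited as a fact; quotations are OBJECT LOCATORS.

WHAT.  [Balaban1987RG1] p.252 L26–34: «take a permutation {π(1), π(2),…} of indices μ with nonzero numbers n_μ, next take |n_{π(1)}| bonds in the direction
sign n_{π(1)} e_{π(1)} starting at y, … We define G(y,x) as the family of contours generated by all such permutations.»  S1∕S1b type the comb with a FULL axis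
order σ ∈ S_d (`axialPermList σ`); this file proves that only the induced order of the MOVING axes matters: `stairFrom l A p x` = the staircase word
moving the listed axes in order from the current point `p` to the target coordinates of `x`; `combOrder σ y x` = `(axesDesc d).map σ` filtered to
`{i : x i ≠ y i}`; THEOREMS `axial_eq_stairFrom` (the cell's comb is the staircase word of ALL axes in the order d−1, …, 0), `stairFrom_P1` (transport:
the staircase of the pulled-back form along `l` from `σ⁻¹•p` to `σ⁻¹•x` is the staircase of the form along `l.map σ`), `stairFrom_filter` (idle axes drop),
and **`axialPermList_eq_stairFrom : axialPermList σ A y x = stairFrom (combOrder σ y x) A y x`**, `axialPerm_eq_of_combOrder_eq` (two orders with the same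
induced moving order give the same contour integral).  PART 2 (the fibre count `#{σ : combOrder σ y x = l}·m! = d!` and the weight identity «uniform
S_d-mean = |G(y,x)|⁻¹-mean») is the remaining half of I-d1ref34-2 (i) — pure counting on `Equiv.Perm (Fin d)`, no geometry; LEAF OFFER «S1c ORDER-COUNT» part 2.
NOT D1, NOT BetaPertH, NOT continuum, NOT Clay.
HONEST DEPENDENCY (verbatim): «continuum YM on T⁴ ⇐ BetaPertH ∧ nine spine estimates (0/9 proved); BetaPertH ⇐ (D1) ∧ (D4) ∧ CAP+tail;
G-an2-4 gates asym, D1 and NE2/3/4.»  ABSOLUTE RULE (cell, verbatim): «No internally-minted statement may enter as a cited fact. Every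
hypothesis is either kernel-proved in this package or a verbatim quotation of a PUBLISHED theorem with page reference.»
Unit `b2b-balaban-beta-an2` gen 25 (row-D1 owner), 2026-08-21.
-/

namespace Summit.QuantumFields.BalabanUV.Beta.SymmetrisedContourOrder

noncomputable section

open Finset
open scoped BigOperators
open Literature.MathematicalPhysics.QuantumFieldTheory.Balaban1983to89.Beta
open AffineAveraging (Form0 Form1 Site unitVec unitVec_apply)
open AveragingContours (corner axial axialAux seg segUp segDown)
open Summit.QuantumFields.BalabanUV.Beta.KernelPermutation (psite psite_apply psite_symm_apply psite_add psite_smul psite_sub)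
open Summit.QuantumFields.BalabanUV.Beta.ResolventPermutation (P1 P1_apply psite_unitVec)
open Summit.QuantumFields.BalabanUV.Beta.SymmetrisedAxialPotential
open Summit.QuantumFields.BalabanUV.Beta.SymmetrisedLoopWords

variable {d : ℕ}

/-! ## §1 The staircase word of an axis list -/

/-- [our object] **THE STAIRCASE WORD** of the axis list `l`: from the current point `p`, move the axes of `l` in order, each by the straight segment
(`AveragingContours.seg`) from the current point to the target coordinate `x i`, updating the current point. -/
def stairFrom : List (Fin d) → Form1 d ℝ → Site d → Site d → List ℝ
  | [], _, _, _ => []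
  | i :: l, A, p, x => seg A p i (x i - p i) ++ stairFrom l A (Function.update p i (x i)) x

/-- [folklore] Unfolding on a cons. -/
theorem stairFrom_cons (i : Fin d) (l : List (Fin d)) (A : Form1 d ℝ) (p x : Site d) :
    stairFrom (i :: l) A p x = seg A p i (x i - p i) ++ stairFrom l A (Function.update p i (x i)) x := rfl

/-- [folklore] The empty list gives the empty word. -/
@[simp] theorem stairFrom_nil (A : Form1 d ℝ) (p x : Site d) : stairFrom [] A p x = [] := rfl

/-- [folklore] A zero-length segment is empty. -/
theorem seg_zero (A : Form1 d ℝ) (z : Site d) (κ : Fin d) : seg A z κ 0 = [] := by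
  simp [seg, segUp]

/-- [folklore] An IDLE axis (`x i = p i`) contributes nothing and does not move the current point. -/
theorem stairFrom_cons_of_eq {i : Fin d} {p x : Site d} (h : x i = p i) (l : List (Fin d)) (A : Form1 d ℝ) :
    stairFrom (i :: l) A p x = stairFrom l A p x := by
  rw [stairFrom_cons, h, sub_self, seg_zero, List.nil_append, Function.update_eq_self]

/-! ## §2 The cell's comb is the staircase word of all axes in the order `d−1, …, 0` -/

/-- [our object] The descending list of the axes below `m`: `[m−1, m−2, …, 0]` (as elements of `Fin d`, for `m ≤ d`). -/
def axesBelow : (m : ℕ) → m ≤ d → List (Fin d)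
  | 0, _ => []
  | m + 1, h => ⟨m, h⟩ :: axesBelow m (Nat.le_of_succ_le h)

/-- [our object] ALL axes, descending: `[d−1, …, 0]` — the order in which `AveragingContours.axial` moves them. -/
def axesDesc (d : ℕ) : List (Fin d) := axesBelow d le_rfl

/-- [folklore] Updating the corner at the axis being moved gives the next corner (cf. `AveragingContours.corner_succ_add`). -/
theorem update_corner_succ (y x : Site d) {m : ℕ} (h : m < d) :
    Function.update (corner y x (m + 1)) ⟨m, h⟩ (x ⟨m, h⟩) = corner y x m := by
  funext j
  by_cases hj : j = ⟨m, h⟩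
  · subst hj
    simp [corner]
  · rw [Function.update_of_ne hj]
    have hj' : (j : ℕ) ≠ m := fun e => hj (Fin.ext e)
    simp only [corner]
    by_cases h1 : m + 1 ≤ (j : ℕ)
    · simp [h1, show m ≤ (j : ℕ) by omega]
    · simp [h1, show ¬ m ≤ (j : ℕ) by omega]

/-- [folklore] The partial comb from `corner y x m` is the staircase word of `axesBelow m` from that corner. -/
theorem axialAux_eq_stairFrom (A : Form1 d ℝ) (y x : Site d) : ∀ (m : ℕ) (h : m ≤ d), axialAux A y x m = stairFrom (axesBelow m h) A (corner y x m) x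
  | 0, _ => by simp [axialAux, axesBelow]
  | m + 1, h => by
    have hm : m < d := h
    rw [axesBelow, stairFrom_cons, axialAux, dif_pos hm, axialAux_eq_stairFrom A y x m (Nat.le_of_succ_le h), update_corner_succ y x hm]
    congr 2
    simp [corner]

/-- [folklore] **THE COMB IS THE STAIRCASE WORD OF ALL AXES** in the order `d−1, …, 0`, from `y`. -/
theorem axial_eq_stairFrom (A : Form1 d ℝ) (y x : Site d) : axial A y x = stairFrom (axesDesc d) A y x := by
  rw [axial, axialAux_eq_stairFrom A y x d le_rfl, axesDesc, AveragingContours.corner_d]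

/-! ## §3 Transport of the staircase word along an axis permutation -/

/-- [folklore] Straight segments of the pulled-back form: `seg (P1 σ A) (σ⁻¹•p) i n = seg A p (σ i) n`. -/
theorem seg_P1 (σ : Equiv.Perm (Fin d)) (A : Form1 d ℝ) (p : Site d) (i : Fin d) (n : ℤ) :
    seg (P1 σ A) ((psite σ).symm p) i n = seg A p (σ i) n := by
  unfold seg segUp segDown
  split_ifs <;> simp only [P1_apply, psite_add, psite_sub, psite_smul, psite_unitVec, Equiv.apply_symm_apply]

/-- [folklore] Updating a coordinate commutes with the inverse action: `σ⁻¹•(update p (σ i) v) = update (σ⁻¹•p) i v`. -/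
theorem psite_symm_update (σ : Equiv.Perm (Fin d)) (p : Site d) (i : Fin d) (v : ℤ) :
    (psite σ).symm (Function.update p (σ i) v) = Function.update ((psite σ).symm p) i v := by
  funext j
  simp only [psite_symm_apply, Function.update_apply, Equiv.apply_eq_iff_eq]

/-- [folklore] **TRANSPORT**: the staircase of `P1 σ A` along `l` between the pulled-back points is the staircase of `A` along `l.map σ`. -/
theorem stairFrom_P1 (σ : Equiv.Perm (Fin d)) (A : Form1 d ℝ) (x : Site d) :
    ∀ (l : List (Fin d)) (p : Site d), stairFrom l (P1 σ A) ((psite σ).symm p) ((psite σ).symm x) = stairFrom (l.map σ) A p x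
  | [], p => rfl
  | i :: l, p => by
    rw [List.map_cons, stairFrom_cons, stairFrom_cons, psite_symm_apply, psite_symm_apply, seg_P1, ← psite_symm_update, stairFrom_P1 σ A x l]

/-! ## §4 Idle axes drop out -/

/-- [folklore] **IDLE AXES DROP**: along any axis list, from any intermediate point `p` whose coordinates are each either still at `y` or already at `x`,
the staircase word equals that of the sub-list of MOVING axes `{i : x i ≠ y i}`. -/
theorem stairFrom_filter (A : Form1 d ℝ) (y x : Site d) :
    ∀ (l : List (Fin d)) (p : Site d), (∀ i, p i = y i ∨ p i = x i) → stairFrom l A p x = stairFrom (l.filter fun i => x i ≠ y i) A p x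
  | [], _, _ => by simp
  | i :: l, p, hp => by
    by_cases hi : x i ≠ y i
    · rw [List.filter_cons_of_pos (by simpa using hi), stairFrom_cons, stairFrom_cons, stairFrom_filter A y x l]
      intro j
      by_cases hj : j = i
      · subst hj; right; simp
      · rw [Function.update_of_ne hj]; exact hp j
    · have hxy : x i = y i := not_not.mp hi
      have hpi : x i = p i := by rcases hp i with h | h <;> [rw [h, hxy]; rw [h]]
      rw [List.filter_cons_of_neg (by simpa using hxy), stairFrom_cons_of_eq hpi, stairFrom_filter A y x l p hp]

/-! ## §5 The σ-comb as the staircase word of the induced moving order -/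

/-- [our object] **THE INDUCED ORDER OF THE MOVING AXES**: the axes `i` with `x i ≠ y i`, in the order `σ(d−1), σ(d−2), …, σ(0)` in which `Γ^σ_{y,x}` moves them
(B12 p.252: «a permutation of indices μ with nonzero numbers n_μ»). -/
def combOrder (σ : Equiv.Perm (Fin d)) (y x : Site d) : List (Fin d) := ((axesDesc d).map σ).filter fun i => x i ≠ y i

/-- [folklore] **`Γ^σ_{y,x}` AS LETTERS = THE STAIRCASE WORD OF `combOrder σ y x`** — the σ-comb depends on σ only through the induced order of the moving axes. -/
theorem axialPermList_eq_stairFrom (σ : Equiv.Perm (Fin d)) (A : Form1 d ℝ) (y x : Site d) :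
    axialPermList σ A y x = stairFrom (combOrder σ y x) A y x := by
  rw [axialPermList, axial_eq_stairFrom, stairFrom_P1, combOrder]
  exact stairFrom_filter A y x _ y (fun i => Or.inl rfl)

/-- [folklore] The contour integral likewise. -/
theorem axialPerm_eq_stairFrom_sum (σ : Equiv.Perm (Fin d)) (A : Form1 d ℝ) (y x : Site d) :
    axialPerm σ A y x = (stairFrom (combOrder σ y x) A y x).sum := by
  rw [← axialPermList_sum, axialPermList_eq_stairFrom]

/-- [folklore] **TWO ORDERS WITH THE SAME INDUCED MOVING ORDER GIVE THE SAME CONTOUR** (letters and integral). -/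
theorem axialPermList_eq_of_combOrder_eq {σ σ' : Equiv.Perm (Fin d)} {y x : Site d} (h : combOrder σ y x = combOrder σ' y x) (A : Form1 d ℝ) :
    axialPermList σ A y x = axialPermList σ' A y x := by
  rw [axialPermList_eq_stairFrom, axialPermList_eq_stairFrom, h]

/-- [folklore] The same for the integrals `axialPerm`. -/
theorem axialPerm_eq_of_combOrder_eq {σ σ' : Equiv.Perm (Fin d)} {y x : Site d} (h : combOrder σ y x = combOrder σ' y x) (A : Form1 d ℝ) :
    axialPerm σ A y x = axialPerm σ' A y x := by
  rw [axialPerm_eq_stairFrom_sum, axialPerm_eq_stairFrom_sum, h]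

end

end Summit.QuantumFields.BalabanUV.Beta.SymmetrisedContourOrder
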